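import Summits.QuantumFields.YangMills.Theorems.BalabanLadderIRAbstractBasinRung
import HarnessLib

/-!
# The term-wise symmetric class 𝔉 lies in EVERY basin — part 1 of 2: the family 𝔉, dominance at the pure scale, super-exponential decay (theorems in `…TermwiseBasin.lean`)

AUTHORSHIP: written and kernel-checked by the critic seat ym-ir-crit-3 g0 (`pub/ym-ir/ym-ir-crit-3/PROBE-termwise-basin.lean` 44a81990b425,
PRELOAD-abstractBasin64.md §5.1–5.2, 2026-08-28T04:24Z; "landable as a Negative-side helper by any seat with propose rights"); landed verbatim modulo
namespace / `#print` removal by ideator ym-ir-idea-9 under RULING director-ym g9-№2 / №14(3).  The crux `BalabanLadder.IR` (stmt-QuantumFields-19354) is NOT proved.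
HONEST FRAMING: abstract bookkeeping about an explicit family of functions `ℕ⁴ → ℝ`; nothing here touches Yang–Mills content; the YM mass
gap (Clay) is NOT proved by any of this; R4 closes only `BalabanLadder.UV`.

𝔉 = finite sums of self-symmetric atoms `N · k₁^{e₁} · k₂^{e₂} · k₃^{e₃} · e^{−κ e₄}` (`N, k₁, k₂, k₃` positive integers, `κ` real; `e_k` the
elementary symmetric polynomials of the four sides).  THEOREM `termwise_defect_le`: if `boxDefect Z L₀ ≤ θ < 1/2` at ONE `L₀ ≥ 4` then for every
`L ≥ L₀`, `boxDefect Z L ≤ 2 · exp(ρ · log(θ/(1−θ)))` with `ρ = (L³⌊L/4⌋)/(L₀³⌊L₀/4⌋) ≥ 1`; COROLLARY `termwise_defect_double_le`: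
`boxDefect Z (2L₀) ≤ 2 (θ/(1−θ))^16` (`0 < θ < 1/2`); INSTANCE `termwise_eighth_to_epsStar`: `boxDefect Z L₀ ≤ 1/8 ⇒ boxDefect Z (2L₀) ≤ epsStar`
— so no 𝔉-datum can refute any `AbstractBasin θ ε` with `θ < 1/2`, `ε ≥ 2(θ/(1−θ))^16` (θ = 1/8: 2·7⁻¹⁶ ≈ 6·10⁻¹⁴ < epsStar = 2⁻²⁴);
the class hypotheses `IsAxisSymmetric / IsTracePositive / HasVolumeBounds` are not even used.  Mechanism: at the pure scale the
top atom has cross-section weight `W < 1/(1−θ) ≤ 2`, hence `W = 1`, hence it is the pure volume term `e^{−κ₁e₄}` (`eq_one_of_W_eq_one`);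
every other atom's log-ratio `F_j(L,⌊L/4⌋)` has non-negative entropy coefficients and the same volume rate, so
`(L₀³t₀)·F_j(L,t) ≤ (L³t)·F_j(L₀,t₀)` (`Fexp_scaled_le`) and `F_j(L₀,t₀) ≤ log(θ/(1−θ)) < 0` decays super-exponentially.
0 sorry; axioms {propext, Classical.choice, Quot.sound}.  Author: ym-ir-crit-3 g0 (refuter-ym-ir-crit-3-g0-0), 2026-08-28.
-/

set_option autoImplicit false

noncomputable section

open scoped BigOperators
open Finset
open Summit.QuantumFields.YangMills.Cruxes.IR.AspectBootstrap

namespace Summit.QuantumFields.YangMills.Cruxes.IR.BasinRung.Termwise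

/-! ## §1 The family -/

/-- `e₁ = a+b+c+d`. -/
def e1 (a b c d : ℕ) : ℕ := a + b + c + d
/-- `e₂ = Σ pairs`. -/
def e2 (a b c d : ℕ) : ℕ := a * b + a * c + a * d + b * c + b * d + c * d
/-- `e₃ = Σ triples`. -/
def e3 (a b c d : ℕ) : ℕ := a * b * c + a * b * d + a * c * d + b * c * d

/-- A self-symmetric atom `N · k₁^{e₁} · k₂^{e₂} · k₃^{e₃} · e^{−κ·abcd}`. -/
def fterm (N k₁ k₂ k₃ : ℕ) (κ : ℝ) (a b c d : ℕ) : ℝ :=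
  (N : ℝ) * (k₁ : ℝ) ^ e1 a b c d * (k₂ : ℝ) ^ e2 a b c d * (k₃ : ℝ) ^ e3 a b c d *
    Real.exp (-(κ * ((a * b * c * d : ℕ) : ℝ)))

variable {ι : Type*}

/-- A term-wise symmetric datum: a finite sum of self-symmetric atoms. -/
def FSum (s : Finset ι) (N k₁ k₂ k₃ : ι → ℕ) (κ : ι → ℝ) (a b c d : ℕ) : ℝ :=
  ∑ j ∈ s, fterm (N j) (k₁ j) (k₂ j) (k₃ j) (κ j) a b c d

/-- cross-section weight at the cube `L³`: `W = N k₁^{3L} k₂^{3L²} k₃^{L³}` (a natural number). -/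
def W (N k₁ k₂ k₃ : ℕ) (L : ℕ) : ℕ := N * k₁ ^ (3 * L) * k₂ ^ (3 * L ^ 2) * k₃ ^ (L ^ 3)

/-- the atom in the fourth direction at the cube `L³`: `μ = k₁ k₂^{3L} k₃^{3L²} e^{−κL³}` (a positive real). -/
def mu (k₁ k₂ k₃ : ℕ) (κ : ℝ) (L : ℕ) : ℝ := (k₁ : ℝ) * (k₂ : ℝ) ^ (3 * L) * (k₃ : ℝ) ^ (3 * L ^ 2) * Real.exp (-(κ * (L : ℝ) ^ 3))

/-- `fterm_cube` (crit-3 probe lemma; see the module docstring). -/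
theorem fterm_cube (N k₁ k₂ k₃ : ℕ) (κ : ℝ) (L τ : ℕ) :
    fterm N k₁ k₂ k₃ κ L L L τ = (W N k₁ k₂ k₃ L : ℝ) * mu k₁ k₂ k₃ κ L ^ τ := by
  unfold fterm W mu e1 e2 e3
  have h1 : L + L + L + τ = 3 * L + τ := by ring
  have h2 : L * L + L * L + L * τ + L * L + L * τ + L * τ = 3 * L ^ 2 + (3 * L) * τ := by ring
  have h3 : L * L * L + L * L * τ + L * L * τ + L * L * τ = L ^ 3 + (3 * L ^ 2) * τ := by ring
  rw [h1, h2, h3]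
  have h4 : Real.exp (-(κ * ((L * L * L * τ : ℕ) : ℝ))) = Real.exp (-(κ * (L : ℝ) ^ 3)) ^ τ := by
    rw [← Real.exp_nat_mul]; congr 1; push_cast; ring
  rw [h4]
  push_cast
  rw [pow_add, pow_add, pow_add, pow_mul, pow_mul]
  ring

/-- `mu_pos` (crit-3 probe lemma; see the module docstring). -/
theorem mu_pos {k₁ k₂ k₃ : ℕ} (hk₁ : 1 ≤ k₁) (hk₂ : 1 ≤ k₂) (hk₃ : 1 ≤ k₃) (κ : ℝ) (L : ℕ) : 0 < mu k₁ k₂ k₃ κ L := by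
  unfold mu
  have : (0 : ℝ) < k₁ := by exact_mod_cast hk₁
  have : (0 : ℝ) < k₂ := by exact_mod_cast hk₂
  have : (0 : ℝ) < k₃ := by exact_mod_cast hk₃
  positivity

/-- `one_le_W` (crit-3 probe lemma; see the module docstring). -/
theorem one_le_W {N k₁ k₂ k₃ : ℕ} (hN : 1 ≤ N) (hk₁ : 1 ≤ k₁) (hk₂ : 1 ≤ k₂) (hk₃ : 1 ≤ k₃) (L : ℕ) : 1 ≤ W N k₁ k₂ k₃ L := by
  unfold W
  exact Nat.mul_pos (Nat.mul_pos (Nat.mul_pos hN (Nat.pow_pos hk₁)) (Nat.pow_pos hk₂)) (Nat.pow_pos hk₃)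

/-- `W = 1` at some `L ≥ 1` forces `N = k₁ = k₂ = k₃ = 1`. -/
theorem eq_one_of_W_eq_one {N k₁ k₂ k₃ L : ℕ} (hL : 1 ≤ L) (h : W N k₁ k₂ k₃ L = 1) :
    N = 1 ∧ k₁ = 1 ∧ k₂ = 1 ∧ k₃ = 1 := by
  unfold W at h
  have h3 : k₃ ^ (L ^ 3) = 1 := Nat.eq_one_of_mul_eq_one_left h
  have h' := Nat.eq_one_of_mul_eq_one_right h
  have h2 : k₂ ^ (3 * L ^ 2) = 1 := Nat.eq_one_of_mul_eq_one_left h'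
  have h'' := Nat.eq_one_of_mul_eq_one_right h'
  have h1 : k₁ ^ (3 * L) = 1 := Nat.eq_one_of_mul_eq_one_left h''
  have hN : N = 1 := Nat.eq_one_of_mul_eq_one_right h''
  have hL0 : L ≠ 0 := by omega
  refine ⟨hN, ?_, ?_, ?_⟩
  · exact (Nat.pow_eq_one.1 h1).resolve_right (by omega)
  · exact (Nat.pow_eq_one.1 h2).resolve_right (by positivity)
  · exact (Nat.pow_eq_one.1 h3).resolve_right (by positivity)

end Summit.QuantumFields.YangMills.Cruxes.IR.BasinRung.Termwise

namespace Summit.QuantumFields.YangMills.Cruxes.IR.BasinRung.Termwise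

variable {ι : Type*} [DecidableEq ι]

/-! ## §2 Dominance at the pure scale: `δ ≤ θ < 1/2` forces a weight-one top atom carrying all but `θ/(1−θ)` -/

/-- `dominant_of_defect_le` (crit-3 probe lemma; see the module docstring). -/
theorem dominant_of_defect_le {s : Finset ι} (hs : s.Nonempty) (w a : ι → ℝ)
    (hw : ∀ j ∈ s, 1 ≤ w j) (ha : ∀ j ∈ s, 0 < a j) {θ : ℝ} (hθ : θ < 1 / 2)
    (hδ : 1 - (∑ j ∈ s, w j * a j ^ 2) / (∑ j ∈ s, w j * a j) ^ 2 ≤ θ) :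
    ∃ j₁ ∈ s, w j₁ < 2 ∧ (∑ j ∈ s.erase j₁, w j * a j) ≤ θ / (1 - θ) * a j₁ := by
  obtain ⟨j₁, hj₁, hmax⟩ := s.exists_max_image a hs
  set P := ∑ j ∈ s, w j * a j with hPdef
  set Q := ∑ j ∈ s, w j * a j ^ 2 with hQdef
  have hP : 0 < P := Finset.sum_pos (fun j hj => mul_pos (by linarith [hw j hj]) (ha j hj)) hs
  have hQ : Q ≤ a j₁ * P := by
    rw [hQdef, hPdef, Finset.mul_sum]
    refine Finset.sum_le_sum fun j hj => ?_
    have h1 := hmax j hj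
    have h2 := ha j hj
    have h3 := hw j hj
    have h4 : w j * a j * a j ≤ w j * a j * a j₁ := mul_le_mul_of_nonneg_left h1 (by nlinarith)
    nlinarith [h4]
  have hθ1 : 0 < 1 - θ := by linarith
  have h1 : (1 - θ) * P ^ 2 ≤ Q := by
    have h : 1 - θ ≤ Q / P ^ 2 := by linarith
    exact (le_div_iff₀ (by positivity)).1 h
  have h2 : (1 - θ) * P ≤ a j₁ := by
    have h : (1 - θ) * P * P ≤ a j₁ * P := by nlinarith [h1, hQ]
    exact le_of_mul_le_mul_right h hP
  have h3 : w j₁ * a j₁ ≤ P := by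
    rw [hPdef]
    exact Finset.single_le_sum (f := fun j => w j * a j)
      (fun j hj => (mul_pos (by linarith [hw j hj]) (ha j hj)).le) hj₁
  have ha₁ := ha j₁ hj₁
  have hw₁ := hw j₁ hj₁
  refine ⟨j₁, hj₁, ?_, ?_⟩
  · by_contra hc
    push Not at hc
    have h5 : 2 * a j₁ ≤ P := le_trans (by nlinarith) h3
    nlinarith
  · have hrest : ∑ j ∈ s.erase j₁, w j * a j = P - w j₁ * a j₁ := by
      rw [hPdef, ← Finset.sum_erase_add s _ hj₁]
      ring
    rw [hrest, div_mul_eq_mul_div, le_div_iff₀ hθ1]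
    nlinarith [h2, mul_nonneg (mul_nonneg (sub_nonneg.2 hw₁) ha₁.le) hθ1.le]

/-! ## §3 Above the pure scale every other term decays super-exponentially -/

/-- log-ratio exponent of the term `(N,k₁,k₂,k₃,κ)` against the pure volume term `e^{−κ₁e₄}` at the box `(L,L,L,τ)`. -/
def Fexp (N k₁ k₂ k₃ : ℕ) (κ κ₁ : ℝ) (L τ : ℕ) : ℝ :=
  Real.log N + ((3 * L + τ : ℕ) : ℝ) * Real.log k₁ + ((3 * L ^ 2 + 3 * L * τ : ℕ) : ℝ) * Real.log k₂ +
    ((L ^ 3 + 3 * L ^ 2 * τ : ℕ) : ℝ) * Real.log k₃ - (κ - κ₁) * ((L ^ 3 * τ : ℕ) : ℝ)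

/-- `exp_natMul_log` (crit-3 probe lemma; see the module docstring). -/
theorem exp_natMul_log {k : ℕ} (hk : 1 ≤ k) (n : ℕ) : Real.exp ((n : ℝ) * Real.log k) = (k : ℝ) ^ n := by
  rw [Real.exp_nat_mul, Real.exp_log (by exact_mod_cast hk)]

/-- `fterm_cube_eq_exp` (crit-3 probe lemma; see the module docstring). -/
theorem fterm_cube_eq_exp {N k₁ k₂ k₃ : ℕ} (hN : 1 ≤ N) (hk₁ : 1 ≤ k₁) (hk₂ : 1 ≤ k₂) (hk₃ : 1 ≤ k₃)
    (κ κ₁ : ℝ) (L τ : ℕ) :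
    fterm N k₁ k₂ k₃ κ L L L τ =
      Real.exp (Fexp N k₁ k₂ k₃ κ κ₁ L τ) * Real.exp (-(κ₁ * ((L ^ 3 * τ : ℕ) : ℝ))) := by
  unfold fterm Fexp e1 e2 e3
  have h1 : L + L + L + τ = 3 * L + τ := by ring
  have h2 : L * L + L * L + L * τ + L * L + L * τ + L * τ = 3 * L ^ 2 + 3 * L * τ := by ring
  have h3 : L * L * L + L * L * τ + L * L * τ + L * L * τ = L ^ 3 + 3 * L ^ 2 * τ := by ring
  have h4 : L * L * L * τ = L ^ 3 * τ := by ring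
  rw [h1, h2, h3, h4, ← Real.exp_add]
  have h5 : Real.log N + ((3 * L + τ : ℕ) : ℝ) * Real.log k₁ + ((3 * L ^ 2 + 3 * L * τ : ℕ) : ℝ) * Real.log k₂ +
      ((L ^ 3 + 3 * L ^ 2 * τ : ℕ) : ℝ) * Real.log k₃ - (κ - κ₁) * ((L ^ 3 * τ : ℕ) : ℝ) +
      -(κ₁ * ((L ^ 3 * τ : ℕ) : ℝ)) =
      Real.log N + ((3 * L + τ : ℕ) : ℝ) * Real.log k₁ + ((3 * L ^ 2 + 3 * L * τ : ℕ) : ℝ) * Real.log k₂ +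
      ((L ^ 3 + 3 * L ^ 2 * τ : ℕ) : ℝ) * Real.log k₃ + -(κ * ((L ^ 3 * τ : ℕ) : ℝ)) := by ring
  rw [h5, Real.exp_add, Real.exp_add, Real.exp_add, Real.exp_add, Real.exp_log (by exact_mod_cast hN),
    exp_natMul_log hk₁, exp_natMul_log hk₂, exp_natMul_log hk₃]

/-- the pure volume term. -/
theorem fterm_pure (κ : ℝ) (a b c d : ℕ) : fterm 1 1 1 1 κ a b c d = Real.exp (-(κ * ((a * b * c * d : ℕ) : ℝ))) := by
  simp [fterm]

/-- MONOTONICITY of the exponent: `(L₀³τ₀)·F(L,τ) ≤ (L³τ)·F(L₀,τ₀)` for `L ≥ L₀ ≥ 1`, `τ ≥ τ₀ ≥ 1`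
(all entropy coefficients are `≥ 0`; the volume-rate term is the same on both sides). -/
theorem Fexp_scaled_le {N k₁ k₂ k₃ : ℕ} (hN : 1 ≤ N) (hk₁ : 1 ≤ k₁) (hk₂ : 1 ≤ k₂) (hk₃ : 1 ≤ k₃) (κ κ₁ : ℝ)
    {L₀ L τ₀ τ : ℕ} (hL₀ : 1 ≤ L₀) (hL : L₀ ≤ L) (hτ₀ : 1 ≤ τ₀) (hτ : τ₀ ≤ τ) :
    ((L₀ ^ 3 * τ₀ : ℕ) : ℝ) * Fexp N k₁ k₂ k₃ κ κ₁ L τ ≤ ((L ^ 3 * τ : ℕ) : ℝ) * Fexp N k₁ k₂ k₃ κ κ₁ L₀ τ₀ := by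
  unfold Fexp
  have gN : 0 ≤ Real.log N := Real.log_nonneg (by exact_mod_cast hN)
  have g1 : 0 ≤ Real.log k₁ := Real.log_nonneg (by exact_mod_cast hk₁)
  have g2 : 0 ≤ Real.log k₂ := Real.log_nonneg (by exact_mod_cast hk₂)
  have g3 : 0 ≤ Real.log k₃ := Real.log_nonneg (by exact_mod_cast hk₃)
  have rL₀ : (1 : ℝ) ≤ L₀ := by exact_mod_cast hL₀
  have rL : (L₀ : ℝ) ≤ L := by exact_mod_cast hL
  have rτ₀ : (1 : ℝ) ≤ τ₀ := by exact_mod_cast hτ₀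
  have rτ : (τ₀ : ℝ) ≤ τ := by exact_mod_cast hτ
  have hLnn : (0 : ℝ) ≤ L := by linarith
  have hτnn : (0 : ℝ) ≤ τ := by linarith
  -- the four coefficient inequalities
  have c0 : ((L₀ ^ 3 * τ₀ : ℕ) : ℝ) ≤ ((L ^ 3 * τ : ℕ) : ℝ) := by push_cast; gcongr
  have c1 : ((3 * L + τ : ℕ) : ℝ) * ((L₀ ^ 3 * τ₀ : ℕ) : ℝ) ≤ ((3 * L₀ + τ₀ : ℕ) : ℝ) * ((L ^ 3 * τ : ℕ) : ℝ) := by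
    push_cast
    have a1 : (L₀ : ℝ) ^ 2 * τ₀ ≤ (L : ℝ) ^ 2 * τ := by gcongr
    have a2 : (L₀ : ℝ) ^ 3 ≤ (L : ℝ) ^ 3 := by gcongr
    nlinarith [mul_le_mul_of_nonneg_left a1 (by positivity : (0:ℝ) ≤ 3 * L * L₀),
      mul_le_mul_of_nonneg_left a2 (by positivity : (0:ℝ) ≤ τ * τ₀)]
  have c2 : ((3 * L ^ 2 + 3 * L * τ : ℕ) : ℝ) * ((L₀ ^ 3 * τ₀ : ℕ) : ℝ) ≤
      ((3 * L₀ ^ 2 + 3 * L₀ * τ₀ : ℕ) : ℝ) * ((L ^ 3 * τ : ℕ) : ℝ) := by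
    push_cast
    have a1 : (L₀ : ℝ) * τ₀ ≤ (L : ℝ) * τ := by gcongr
    have a2 : (L₀ : ℝ) ^ 2 ≤ (L : ℝ) ^ 2 := by gcongr
    nlinarith [mul_le_mul_of_nonneg_left a1 (by positivity : (0:ℝ) ≤ 3 * L ^ 2 * L₀ ^ 2),
      mul_le_mul_of_nonneg_left a2 (by positivity : (0:ℝ) ≤ 3 * L * τ * L₀ * τ₀)]
  have c3 : ((L ^ 3 + 3 * L ^ 2 * τ : ℕ) : ℝ) * ((L₀ ^ 3 * τ₀ : ℕ) : ℝ) ≤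
      ((L₀ ^ 3 + 3 * L₀ ^ 2 * τ₀ : ℕ) : ℝ) * ((L ^ 3 * τ : ℕ) : ℝ) := by
    push_cast
    nlinarith [mul_le_mul_of_nonneg_left rτ (by positivity : (0:ℝ) ≤ L ^ 3 * L₀ ^ 3),
      mul_le_mul_of_nonneg_left rL (by positivity : (0:ℝ) ≤ 3 * L ^ 2 * τ * L₀ ^ 2 * τ₀)]
  have c4 : ((L₀ ^ 3 * τ₀ : ℕ) : ℝ) * ((κ - κ₁) * ((L ^ 3 * τ : ℕ) : ℝ)) =
      ((L ^ 3 * τ : ℕ) : ℝ) * ((κ - κ₁) * ((L₀ ^ 3 * τ₀ : ℕ) : ℝ)) := by ring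
  nlinarith [mul_le_mul_of_nonneg_left c0 gN, mul_le_mul_of_nonneg_right c1 g1,
    mul_le_mul_of_nonneg_right c2 g2, mul_le_mul_of_nonneg_right c3 g3, c4]

end Summit.QuantumFields.YangMills.Cruxes.IR.BasinRung.Termwise
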